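import Summits.CriticalPhenomena.PercolationContinuityZ3.Theorems.Transplant.FKConnectivityAllQAntipodalTwoSpinePhi
import HarnessLib

/-!
# Connectivity correlation inequalities for `φ_{w,q}` — TWO-SPINE word model: GROUND words and the CRITICALITY LEMMA

Helper file (`--supports stmt-CriticalPhenomena-4575`), FK sub-lane `prim-bschramm-fk-2` (gen 15); builds on p205010 (kernel theorem,
internal audit signed; external expert review pending).  No named facts, no sorries, standard axioms.

Memo `bschramm/FROM-fk-2-g15-TWO-SPINE.md` §12 (V1) / blueprint L2.2.  A letter is GROUND if its part shows only its `λ`-face or is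
invisible: series letters with second bit `true` (`01`, `11`), parallel letters with first bit `false` (`01`, `00`); a word is ground if
all its letters are.  **Criticality lemma** (`phiReachesRoot_absent_iff`): Theorem U's top-down run started from an ABSENT root (type `01`)
reaches the root — i.e. would move the marked edge — iff the word is ground; from a PRESENT root (type `10`) it never does
(`phiReachesRoot_present`).  In the two-spine RULE of memo §11 the critical loser cells (absent-root side ground) are exactly those handled
by the atom involutions; all others by the whole-cell move `Φ_N`.  (Machine mirror: `explore/rule_check.py`, verified K_A+K_B ≤ 7.)
[cite: Grimmett2006, §3.8 (pp. 61–62); §3.9 (p. 63)]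
-/

namespace Summit.CriticalPhenomena.PercolationContinuityZ3.Theorems

namespace FK

namespace TwoSpine

open X2Word

/-- A GROUND letter: series with second bit `true` (`01` or inert `11`), parallel with first bit `false` (`01` or inert `00`). [folklore] -/
def groundLetter (l : SLetter) : Bool :=
  match l.1 with
  | .W => l.2.2
  | .P => !l.2.1

/-- A GROUND word: every letter ground (memo §12: the absent-root side of a critical cell). [folklore] -/
def isGround (w : List SLetter) : Bool := w.all groundLetter

/-- One composition step from the absent root type `(false, true)`: the composite is `01` iff the letter is ground, and then it is
again `(false, true)`. [folklore] -/
theorem compStep_absentRoot (l : SLetter) :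
    is01 (compStep (false, true) l) = groundLetter l ∧ (groundLetter l = true → compStep (false, true) l = (false, true)) := by
  obtain ⟨k, b, bb⟩ := l
  cases k <;> cases b <;> cases bb <;> simp [compStep, is01, groundLetter]

/-- **Criticality lemma**: from an ABSENT root (type `01`) Theorem U's top-down run reaches the root iff the word is ground. [folklore] -/
theorem phiReachesRoot_absent_iff (w : List SLetter) : phiReachesRoot (false, true) w = isGround w := by
  unfold phiReachesRoot isGround
  induction w with
  | nil => simp [comps, allAbove, is01]
  | cons l w ih =>
    obtain ⟨h1, h2⟩ := compStep_absentRoot l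
    simp only [comps, allAbove, List.headD_cons, List.all_cons]
    rcases Bool.eq_false_or_eq_true (groundLetter l) with hg | hg
    · rw [h2 hg, ih, hg]; simp [is01]
    · have hc : is01 (compStep (false, true) l) = false := by rw [h1, hg]
      rw [hc, hg]; simp

/-- From a PRESENT root (type `10`) the run never reaches the root. [folklore] -/
theorem phiReachesRoot_present (w : List SLetter) : phiReachesRoot (true, false) w = false := by
  simp [phiReachesRoot, is01]

/-- On a ground word the absent-root run flips EVERY free letter: the result is the letterwise swap of the free letters
(the 'anti-ground' word of memo §12 V3). [folklore] -/
theorem phiRun_absent_ground {w : List SLetter} (hw : isGround w = true) :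
    phiRun (false, true) w = w.map (fun l => if l.2 == (false, true) then (l.1, true, false) else l) := by
  induction w with
  | nil => rfl
  | cons l w ih =>
    have hg : groundLetter l = true := by simp [isGround] at hw; exact hw.1
    have hw' : isGround w = true := by simp [isGround] at hw ⊢; exact hw.2
    obtain ⟨h1, h2⟩ := compStep_absentRoot l
    have hreach : (allAbove (comps (false, true) w)).headD true = true := by
      have := phiReachesRoot_absent_iff w
      rw [hw'] at this; simpa [phiReachesRoot, is01] using this
    rw [phiRun_cons, h2 hg, List.map_cons, ih hw']
    congr 1
    rw [hreach]; simp [is01]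

end TwoSpine

end FK

end Summit.CriticalPhenomena.PercolationContinuityZ3.Theorems
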